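import Mathlib
import Literature.Computability.AlgebraicComplexity.DeterminantalConormalBoundMixed
import Summits.ValiantsHypothesis.ValiantsHypothesis.Theorems.DetQPDetqpSuperquadraticStubMixedBezoutNondegenerate
import Summits.ValiantsHypothesis.ValiantsHypothesis.Theorems.DetQPDetqpSuperquadraticPolarCountNDJacobian
import Summits.ValiantsHypothesis.ValiantsHypothesis.Theorems.DetQPDetqpSuperquadraticPolarCountNDKernelLift
import Summits.ValiantsHypothesis.ValiantsHypothesis.Theorems.DetQPDetqpSuperquadraticPolarCountNDKernelSystem
import Summits.ValiantsHypothesis.ValiantsHypothesis.Theorems.DetQPDetqpSuperquadraticPolarCountNDTangent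

/-!
# Crux `DetQP.DetqpSuperquadratic` (stmt-ValiantsHypothesis-0318), line `sectional-class-ladder`
# (skeleton v2, ND route) — stub `stub_polarCountND`: Sheshadri's two-kernel Bézout bound
# `B(m, N)` for finite sets of NON-DEGENERATE polar points

For a form `f = det A` (`A` an affine `m × m` matrix in `N ≥ 3` variables) and pencil/chart data
`u = (a, b, c)`, a polar point `x ∈ T_f(a, b, c)` (`Literature….polarSet`: `f(x) = 0`,
`∇f(x) ≠ 0`, `∇f(x) ∈ ℂa + ℂb`, `c·x = 1`) is NON-DEGENERATE when the bordered Hessian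
`[[∂ᵢ∂ⱼf(x), (aᵢ bᵢ)], [(∂ⱼf(x); cⱼ), 0]]` (the Jacobian of the square polar system in
`(x, s, t)`) is invertible. The tree's `Sheshadri2026_polarCount_le_holds`
(`Literature/Computability/AlgebraicComplexity/DeterminantalConormalBoundMixed.lean`,
arXiv:2606.13628 Thm. 3 (i) in polar-count form) bounds the `ncard` of a FINITE polar set by
`B(m, N) = conormalBezout m N`; line `sectional-class-ladder` (v2) certifies and transports
non-degenerate polar points instead, and needs the bound for finite sets of non-degenerate polar
points with no finiteness hypothesis on the whole polar set. This file proves it: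

* `card_le_conormalBezout_of_pencil_nondegenerate` — the tree's
  `ncard_polarSet_le_conormalBezout_of_pencil` (kernel-incidence system of §3.1 on
  `ℙ^N × ℙ^{m-1} × ℙ^{m-1}`, multigraded refined Bézout count) run on a finite set `P` of
  non-degenerate polar points: the lifts `(1 : x, u_x, v_x)`, `x ∈ P`, are NON-DEGENERATE zeros
  of the system — a tangent vector linearises to the data of
  `polarLift_rigidity_of_nondegenerate` (`…PolarCountNDTangent`, `…PolarCountNDJacobian`:
  second-order Jacobi `Hess f(x)δx = δw + λ∇f(x)` and the bordered Hessian) and is therefore a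
  torus direction — so the refined Bézout count of non-degenerate zeros
  (`stub_mixedBezoutNondegenerate`, landed) replaces the count of isolated zeros; the
  multihomogeneity, non-triviality and evaluation of the system and the value `B(m, N)` of the
  mixed Bézout number are `…PolarCountNDKernelSystem` / `…PolarCountNDKernelLift`;
* `stub_polarCountND` — the registered signature: constant `f` has no polar points (`Φ = 1`);
  otherwise `Φ = δ₀ · Π_{i ∉ {j₀,k₀}} χ_i` as in `Sheshadri2026_polarCount_le_holds` (`a ∦ b`, the
  `N − 2` pencil equations non-trivial), with no small-case analysis (the pencil count needs
  neither `deg f ≥ 3` nor finiteness).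

References: K. Sheshadri, arXiv:2606.13628 (2026), §3.1, Lemmas 4–5, eq. (1.1)
[Sheshadri2026Border]; W. Fulton, *Intersection Theory*, 2nd ed., 1998, Example 12.3.1
[Fulton1998].
-/

noncomputable section

-- `Summit.ValiantsHypothesis.ValiantsHypothesis.…` is the tree's mandated single-conjunct layout
-- (Sub = Summit), so the duplicated namespace component is intended.
set_option linter.dupNamespace false

namespace Summit.ValiantsHypothesis.ValiantsHypothesis.Theorems.DetQPDetqpSuperquadratic

open MvPolynomial Matrix Finset
open Literature.Computability.AlgebraicComplexity
open Literature.Computability.AlgebraicComplexity.DeterminantalConormal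
open Literature.RingTheory.MvPolynomial

/-- **Sheshadri's bound for finite sets of NON-DEGENERATE polar points, one generic pencil**
(the tree's `ncard_polarSet_le_conormalBezout_of_pencil` with finiteness of the polar set
replaced by non-degeneracy of the counted points): for `f = det A` with affine-linear entries,
`det A ≠ 0`, covectors with `a_{j₀} b_{k₀} − a_{k₀} b_{j₀} ≠ 0` and all `N − 2` pencil equations
non-trivial, a finite set `P` of polar points at which the bordered Hessian
`[[∂ᵢ∂ⱼf(x), (aᵢ bᵢ)], [(∂ⱼf(x); cⱼ), 0]]` is invertible has at most `B(m, N)` points: the lifts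
`(1 : x, u_x, v_x)` are non-degenerate zeros of the kernel-incidence system
(`kernelSystem_tangent_torus` + `polarLift_rigidity_of_nondegenerate`), counted by
`stub_mixedBezoutNondegenerate`. [cite: Sheshadri2026Border, Lemma 5, eq. (1.1)] -/
theorem card_le_conormalBezout_of_pencil_nondegenerate {σ : Type} [Fintype σ] [DecidableEq σ]
    {m : ℕ} (hσ : 3 ≤ Fintype.card σ) (A : Matrix (Fin (m + 1)) (Fin (m + 1)) (MvPolynomial σ ℂ))
    (hA1 : ∀ k l, (A k l).totalDegree ≤ 1) (hA0 : A.det ≠ 0) (a b c : σ → ℂ) {j₀ k₀ : σ}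
    (hjk : j₀ ≠ k₀) (hδ : a j₀ * b k₀ - a k₀ * b j₀ ≠ 0)
    (hM : ∀ i, i ≠ j₀ → i ≠ k₀ → ∃ k l,
      (a j₀ * b k₀ - a k₀ * b j₀) * coeff (Finsupp.single i 1) (A k l) -
        (b k₀ * coeff (Finsupp.single j₀ 1) (A k l) -
            b j₀ * coeff (Finsupp.single k₀ 1) (A k l)) * a i -
        (a j₀ * coeff (Finsupp.single k₀ 1) (A k l) -
            a k₀ * coeff (Finsupp.single j₀ 1) (A k l)) * b i ≠ 0)
    (P : Finset (σ → ℂ))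
    (hP : ∀ x ∈ P, x ∈ polarSet A.det a b c ∧
      (Matrix.fromBlocks (Matrix.of fun i j : σ => eval x (pderiv i (pderiv j A.det)))
        (Matrix.of fun (i : σ) (l : Fin 2) => ![a i, b i] l)
        (Matrix.of fun (l : Fin 2) (j : σ) => ![eval x (pderiv j A.det), c j] l)
        (0 : Matrix (Fin 2) (Fin 2) ℂ)).det ≠ 0) :
    P.card ≤ conormalBezout (m + 1) (Fintype.card σ) := by
  classical
  haveI : Nonempty σ := ⟨j₀⟩
  -- ### notation: variables `τ = (x₀ ⊔ σ) ⊔ (u ⊔ v)`, blocks `x ↦ 0`, `u ↦ 2`, `v ↦ 1`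
  set x0 : ((Unit ⊕ σ) ⊕ (Fin (m + 1) ⊕ Fin (m + 1))) := Sum.inl (Sum.inl ()) with hx0
  set xv : σ → ((Unit ⊕ σ) ⊕ (Fin (m + 1) ⊕ Fin (m + 1))) := fun i => Sum.inl (Sum.inr i) with hxv
  set uu : Fin (m + 1) → ((Unit ⊕ σ) ⊕ (Fin (m + 1) ⊕ Fin (m + 1))) := fun k => Sum.inr (Sum.inl k)
    with huu
  set vv : Fin (m + 1) → ((Unit ⊕ σ) ⊕ (Fin (m + 1) ⊕ Fin (m + 1))) := fun l => Sum.inr (Sum.inr l)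
    with hvv
  set blk : ((Unit ⊕ σ) ⊕ (Fin (m + 1) ⊕ Fin (m + 1))) → Fin 3 :=
    Sum.elim (fun _ => 0) (Sum.elim (fun _ => 2) (fun _ => 1)) with hblk
  -- ### the homogenised pencil
  set phat : MvPolynomial σ ℂ → MvPolynomial ((Unit ⊕ σ) ⊕ (Fin (m + 1) ⊕ Fin (m + 1))) ℂ :=
    fun p => C (coeff 0 p) * X x0 + ∑ i, C (coeff (Finsupp.single i 1) p) * X (xv i) with hphat
  set Ahat := A.map phat with hAhat
  have hAhat0 : Ahat ≠ 0 := homogenisedPencil_ne_zero A hA1 hA0 x0 xv hx0 hxv phat hphat Ahat hAhat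
  have hrowA : ∀ k, ∃ l, A k l ≠ 0 := by
    intro k
    by_contra h
    push Not at h
    exact hA0 (Matrix.det_eq_zero_of_row_eq_zero k h)
  -- ### the polar points and their kernel data
  have hPmem : ∀ x ∈ P, x ∈ polarSet A.det a b c := fun x hx => (hP x hx).1
  have hND := fun x hx => (hP x hx).2
  have hAi : ∀ (x : σ → ℂ) i, A.map (fun p => eval x (pderiv i p)) =
      A.map (fun p => coeff (Finsupp.single i 1) p) := by
    intro x i; ext k l
    exact eval_pderiv_eq_coeff_of_totalDegree_le_one (hA1 k l) i x
  have hkp : ∀ x ∈ P, ∃ u v : Fin (m + 1) → ℂ, u ≠ 0 ∧ v ≠ 0 ∧ u ᵥ* A.map (eval x) = 0 ∧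
      A.map (eval x) *ᵥ v = 0 ∧ (A.map (eval x)).adjugate = vecMulVec v u ∧
      ∀ i, eval x (pderiv i A.det) =
        u ⬝ᵥ (A.map (fun p => coeff (Finsupp.single i 1) p) *ᵥ v) := by
    intro x hx
    obtain ⟨hfx, hdf, -, -⟩ := hPmem x hx
    obtain ⟨u, v, hu, hv, huM, hMv, hadj, hpd⟩ :=
      exists_kernelPair_of_eval_pderiv_ne_zero A hfx hdf
    exact ⟨u, v, hu, hv, huM, hMv, hadj, fun i => by rw [hpd i, hAi]⟩
  choose! ux vx hux hvx huxM hMvx hadjx hpdx using hkp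
  have hl₂' : ∀ x ∈ P, ∃ l, vx x l ≠ 0 := fun x hx => Function.ne_iff.mp (hvx x hx)
  choose! l₂ hl₂ using hl₂'
  -- ### the reduction matrix
  obtain ⟨Λ, hΛdet, hΛcol⟩ := exists_left_reduction_matrix P vx l₂ hl₂ Ahat hAhat0
  -- ### the system
  set wp : σ → MvPolynomial ((Unit ⊕ σ) ⊕ (Fin (m + 1) ⊕ Fin (m + 1))) ℂ := fun i =>
    ∑ k, ∑ l, C (coeff (Finsupp.single i 1) (A k l)) * X (uu k) * X (vv l) with hwp
  set Q : ((Unit ⊕ Fin (m + 1)) ⊕ (Fin m ⊕ {i : σ // i ≠ j₀ ∧ i ≠ k₀})) →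
      MvPolynomial ((Unit ⊕ σ) ⊕ (Fin (m + 1) ⊕ Fin (m + 1))) ℂ :=
    Sum.elim
      (Sum.elim (fun _ => X x0 - ∑ i, C (c i) * X (xv i)) (fun k => ∑ l, Ahat k l * X (vv l)))
      (Sum.elim
        (fun j => ∑ k, X (uu k) * (Ahat * Λ.map (fun r : ℂ =>
          (C r : MvPolynomial ((Unit ⊕ σ) ⊕ (Fin (m + 1) ⊕ Fin (m + 1))) ℂ))) k j)
        (fun i => C (a j₀ * b k₀ - a k₀ * b j₀) * wp i.1 -
          (C (b k₀) * wp j₀ - C (b j₀) * wp k₀) * C (a i.1) -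
          (C (a j₀) * wp k₀ - C (a k₀) * wp j₀) * C (b i.1))) with hQ
  set δ : ((Unit ⊕ Fin (m + 1)) ⊕ (Fin m ⊕ {i : σ // i ≠ j₀ ∧ i ≠ k₀})) → Fin 3 → ℕ :=
    Sum.elim (Sum.elim (fun _ => Pi.single 0 1) (fun _ => Pi.single 0 1 + Pi.single 1 1))
      (Sum.elim (fun _ => Pi.single 0 1 + Pi.single 2 1) (fun _ => Pi.single 1 1 + Pi.single 2 1))
    with hδdef
  set z : (σ → ℂ) → ((Unit ⊕ σ) ⊕ (Fin (m + 1) ⊕ Fin (m + 1))) → ℂ := fun x =>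
    Sum.elim (Sum.elim (fun _ => 1) x) (Sum.elim (ux x) (vx x)) with hz
  set T := P.image z with hT
  have hzx0 : ∀ x, z x x0 = 1 := fun x => by simp [hz, hx0]
  have hzxv : ∀ x i, z x (xv i) = x i := fun x i => by simp [hz, hxv]
  have hzuu : ∀ x k, z x (uu k) = ux x k := fun x k => by simp [hz, huu]
  have hzvv : ∀ x l, z x (vv l) = vx x l := fun x l => by simp [hz, hvv]
  have hzinj : Function.Injective z := by
    intro x x₂ h
    funext i
    rw [← hzxv x i, ← hzxv x₂ i, h]
  -- ### hypotheses of the refined Bézout count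
  have hblk' : ∀ l : Fin 3, ∃ t, blk t = l := by
    intro l
    fin_cases l
    exacts [⟨x0, by simp [hblk, hx0]⟩, ⟨vv 0, by simp [hblk, hvv]⟩, ⟨uu 0, by simp [hblk, huu]⟩]
  have hcardS : Fintype.card {i : σ // i ≠ j₀ ∧ i ≠ k₀} = Fintype.card σ - 2 := by
    rw [Fintype.card_subtype]
    have hset : (univ.filter fun i : σ => i ≠ j₀ ∧ i ≠ k₀) = (univ.erase j₀).erase k₀ := by
      ext i
      simp only [Finset.mem_filter, Finset.mem_univ, true_and, Finset.mem_erase, and_true]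
      tauto
    rw [hset, Finset.card_erase_of_mem (Finset.mem_erase.mpr ⟨hjk.symm, Finset.mem_univ _⟩),
      Finset.card_erase_of_mem (Finset.mem_univ _), Finset.card_univ]
    omega
  have hr' : Fintype.card ((Unit ⊕ Fin (m + 1)) ⊕ (Fin m ⊕ {i : σ // i ≠ j₀ ∧ i ≠ k₀})) +
      Fintype.card (Fin 3) = Fintype.card ((Unit ⊕ σ) ⊕ (Fin (m + 1) ⊕ Fin (m + 1))) := by
    simp only [Fintype.card_sum, Fintype.card_fin, Fintype.card_unit, hcardS]
    omega
  have hQ' : ∀ j, (Q j).IsWeightedHomogeneous (fun t => (Pi.single (blk t) 1 : Fin 3 → ℕ)) (δ j) :=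
    isWeightedHomogeneous_kernelSystem A a b c Λ x0 xv uu vv phat hphat Ahat hAhat wp hwp Q hQ
      blk (by simp [hblk, hx0]) (fun i => by simp [hblk, hxv]) (fun k => by simp [hblk, huu])
      (fun l => by simp [hblk, hvv]) δ hδdef
  have hQ0' : ∀ j, Q j ≠ 0 :=
    kernelSystem_ne_zero A hA1 hrowA a b c Λ x0 xv uu vv hx0 hxv huu hvv phat hphat Ahat hAhat
      wp hwp Q hQ hΛcol hM
  -- the targets
  have hT' : ∀ z' ∈ T, ∀ l, ∃ t, blk t = l ∧ z' t ≠ 0 := by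
    intro z' hz' l
    obtain ⟨x, hx, rfl⟩ := Finset.mem_image.mp hz'
    fin_cases l
    · exact ⟨x0, by simp [hblk, hx0], by rw [hzx0]; exact one_ne_zero⟩
    · exact ⟨vv (l₂ x), by simp [hblk, hvv], by rw [hzvv]; exact hl₂ x hx⟩
    · obtain ⟨k, hk⟩ := Function.ne_iff.mp (hux x hx)
      exact ⟨uu k, by simp [hblk, huu], by rw [hzuu]; exact hk⟩
  have hTdist' : ∀ z₁ ∈ T, ∀ z₂ ∈ T, (∃ cc : Fin 3 → ℂ, z₂ = fun t => cc (blk t) * z₁ t) →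
      z₂ = z₁ := by
    rintro z₁ hz₁ z₂ hz₂ ⟨cc, hcc⟩
    obtain ⟨x, hx, rfl⟩ := Finset.mem_image.mp hz₁
    obtain ⟨x₂, hx₂, rfl⟩ := Finset.mem_image.mp hz₂
    have hb0 : blk x0 = 0 := by simp [hblk, hx0]
    have hbv : ∀ i, blk (xv i) = 0 := fun i => by simp [hblk, hxv]
    have h0 : cc 0 = 1 := by
      have h1 := congrFun hcc x0
      rw [hb0, hzx0, hzx0, mul_one] at h1
      exact h1.symm
    have hxx : x₂ = x := by
      funext i
      have h1 := congrFun hcc (xv i)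
      rw [hbv, h0, one_mul, hzxv, hzxv] at h1
      exact h1
    rw [hxx]
  have hTQ' : ∀ z' ∈ T, ∀ j, eval z' (Q j) = 0 := by
    intro z' hz' j
    obtain ⟨x, hx, rfl⟩ := Finset.mem_image.mp hz'
    obtain ⟨-, -, hspan, hcx⟩ := hPmem x hx
    exact kernelSystem_eval_lift_eq_zero A hA1 a b c hδ Λ x0 xv uu vv hx0 hxv huu hvv phat hphat
      Ahat hAhat wp hwp Q hQ x (ux x) (vx x) (huxM x hx) (hMvx x hx) (hpdx x hx) hspan hcx (z x)
      rfl j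
  -- non-degeneracy: tangent vectors at the lifted non-degenerate polar points are torus vectors
  have hnd' : ∀ z' ∈ T, ∀ W : ((Unit ⊕ σ) ⊕ (Fin (m + 1) ⊕ Fin (m + 1))) → ℂ,
      (∀ j, ∑ t, eval z' (pderiv t (Q j)) * W t = 0) →
        ∃ cc : Fin 3 → ℂ, W = fun t => cc (blk t) * z' t := by
    intro z' hz' W hW
    obtain ⟨x, hx, rfl⟩ := Finset.mem_image.mp hz'
    obtain ⟨-, -, hspan, hcx⟩ := hPmem x hx
    refine kernelSystem_tangent_torus A hA1 a b c Λ x0 xv uu vv hx0 hxv huu hvv phat hphat Ahat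
      hAhat wp hwp Q hQ blk hblk x (ux x) (vx x) (huxM x hx) (hMvx x hx) hcx
      (fun δx δu δv E hE δw hδw ha hb hc hd => polarLift_rigidity_of_nondegenerate A hA1 a b c hδ
        Λ x (ux x) (vx x) (hux x hx) (hvx x hx) (huxM x hx) (hMvx x hx) (hadjx x hx) (hpdx x hx)
        hspan (hl₂ x hx) (hΛdet x hx) (hND x hx) δx δu δv E hE δw hδw ha hb hc hd)
      (z x) rfl W fun j => ?_
    rw [PolarCountND.eval_mkDerivation_eq_sum]
    exact hW j
  -- ### the refined Bézout count and the mixed Bézout number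
  have key := stub_mixedBezoutNondegenerate blk hblk' hr' Q δ hQ' hQ0' T hT' hTdist' hTQ' hnd'
  rw [hT, Finset.card_image_of_injective P hzinj] at key
  exact key.trans (le_of_eq
    (coeff_kernelSystemDegrees_eq_conormalBezout hσ hjk blk hblk δ hδdef))

/-- **Registered sub-goal `stub_polarCountND` — Sheshadri's bound `B(m, N)` for finite sets of
NON-DEGENERATE polar points** (arXiv:2606.13628, §3.1, eq. (1.1), with the finiteness of the
polar set replaced by non-degeneracy of the counted points): if a form `f` in `N ≥ 3` variables
has an affine `m × m` determinantal representation, then there is a non-zero polynomial `Φ` in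
the pencil/chart data `u = (a, b, c)` such that for `Φ(u) ≠ 0` every finite set `T` of polar
points of `f` at which the bordered Hessian `[[∂ᵢ∂ⱼf(x), (aᵢ bᵢ)], [(∂ⱼf(x); cⱼ), 0]]` is
invertible has `|T| ≤ B(m, N)`. Constant `f`: no polar points, `Φ = 1`. Otherwise
`Φ = δ₀ · Π_{i ∉ {j₀,k₀}} χ_i` exactly as in `Sheshadri2026_polarCount_le_holds` (`a ∦ b` and the
`N − 2` pencil equations non-trivial) and the count is
`card_le_conormalBezout_of_pencil_nondegenerate`.
[cite: Sheshadri2026Border, §3.1; Fulton1998, Example 12.3.1] -/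
theorem stub_polarCountND {N : ℕ} (hN : 3 ≤ N) (f : MvPolynomial (Fin N) ℂ) (d m : ℕ)
    (hf : f.IsHomogeneous d) (hm : HasDetRepr f m) :
    ∃ Φ : MvPolynomial (Fin 3 × Fin N) ℂ, Φ ≠ 0 ∧ ∀ u : Fin 3 × Fin N → ℂ, eval u Φ ≠ 0 →
      ∀ T : Finset (Fin N → ℂ),
        (∀ x ∈ T, x ∈ polarSet f (fun i => u (0, i)) (fun i => u (1, i)) (fun i => u (2, i)) ∧
          (Matrix.fromBlocks
            (Matrix.of fun i j : Fin N => eval x (pderiv i (pderiv j f)))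
            (Matrix.of fun (i : Fin N) (l : Fin 2) => ![u (0, i), u (1, i)] l)
            (Matrix.of fun (l : Fin 2) (j : Fin N) => ![eval x (pderiv j f), u (2, j)] l)
            (0 : Matrix (Fin 2) (Fin 2) ℂ)).det ≠ 0) →
        T.card ≤ conormalBezout m N := by
  classical
  have _hd : f.IsHomogeneous d := hf
  -- ### constant `f`: no polar points at all
  by_cases hdeg0 : f.totalDegree = 0
  · refine ⟨1, one_ne_zero, fun u _ T hT => ?_⟩
    have hT0 : T = ∅ := by
      refine Finset.eq_empty_of_forall_notMem fun x hx => ?_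
      obtain ⟨⟨-, ⟨i, hi⟩, -, -⟩, -⟩ := hT x hx
      apply hi
      rw [totalDegree_eq_zero_iff_eq_C.mp hdeg0, pderiv_C, map_zero]
    rw [hT0, Finset.card_empty]
    exact Nat.zero_le _
  -- ### the main case: `f = det A` non-constant
  obtain ⟨A, hA1, rfl⟩ := hm
  obtain ⟨m', rfl⟩ : ∃ m', m = m' + 1 := by
    rcases m with _ | m'
    · exfalso
      apply hdeg0
      rw [Matrix.det_isEmpty, totalDegree_one]
    · exact ⟨m', rfl⟩
  obtain ⟨j₀, ks, ls, hjs⟩ := exists_coeff_single_ne_zero A hA1 hdeg0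
  haveI : Nontrivial (Fin N) := Fintype.one_lt_card_iff_nontrivial.mp (by simp; omega)
  obtain ⟨k₀, hk₀⟩ := exists_ne j₀
  have hf0 : A.det ≠ 0 := fun h => hdeg0 (by rw [h, totalDegree_zero])
  -- ### the genericity polynomial `Φ = δ₀ · Π χ_i`
  set cf : Fin N → ℂ := fun i => coeff (Finsupp.single i 1) (A ks ls) with hcf
  set δp : MvPolynomial (Fin 3 × Fin N) ℂ := X (0, j₀) * X (1, k₀) - X (0, k₀) * X (1, j₀) with hδp
  set χ : Fin N → MvPolynomial (Fin 3 × Fin N) ℂ := fun i => δp * C (cf i) -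
    (X (1, k₀) * C (cf j₀) - X (1, j₀) * C (cf k₀)) * X (0, i) -
    (X (0, j₀) * C (cf k₀) - X (0, k₀) * C (cf j₀)) * X (1, i) with hχ
  have hδp_eval : ∀ u : Fin 3 × Fin N → ℂ,
      eval u δp = u (0, j₀) * u (1, k₀) - u (0, k₀) * u (1, j₀) := by
    intro u; simp [hδp]
  have hχ_eval : ∀ (u : Fin 3 × Fin N → ℂ) i, eval u (χ i) =
      (u (0, j₀) * u (1, k₀) - u (0, k₀) * u (1, j₀)) * cf i -
        (u (1, k₀) * cf j₀ - u (1, j₀) * cf k₀) * u (0, i) -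
        (u (0, j₀) * cf k₀ - u (0, k₀) * cf j₀) * u (1, i) := by
    intro u i; simp [hχ, hδp]
  refine ⟨δp * ∏ i ∈ univ.filter (fun i => i ≠ j₀ ∧ i ≠ k₀), χ i, ?_, fun u hu T hT => ?_⟩
  · refine mul_ne_zero ?_ (Finset.prod_ne_zero_iff.mpr fun i hi => ?_)
    · intro h
      have h1 := congrArg (eval (fun p : Fin 3 × Fin N =>
        if p = (0, j₀) ∨ p = (1, k₀) then (1 : ℂ) else 0)) h
      rw [hδp_eval, map_zero] at h1
      simp [hk₀] at h1
    · obtain ⟨hij, hik⟩ := (Finset.mem_filter.mp hi).2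
      intro h
      have h1 := congrArg (eval (fun p : Fin 3 × Fin N =>
        if p = (0, i) ∨ p = (1, k₀) then (1 : ℂ) else 0)) h
      rw [hχ_eval, map_zero] at h1
      simp [hk₀.symm, hik, Ne.symm hij, Ne.symm hik, hcf, hjs] at h1
  · rw [map_mul, map_prod] at hu
    have hδ : u (0, j₀) * u (1, k₀) - u (0, k₀) * u (1, j₀) ≠ 0 := by
      rw [← hδp_eval]; exact left_ne_zero_of_mul hu
    have hprod := right_ne_zero_of_mul hu
    rw [Finset.prod_ne_zero_iff] at hprod
    have key := card_le_conormalBezout_of_pencil_nondegenerate (m := m') (by simp; omega) A hA1 hf0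
      (fun i => u (0, i)) (fun i => u (1, i)) (fun i => u (2, i)) hk₀.symm hδ
      (fun i hij hik => ⟨ks, ls, ?_⟩) T hT
    · simpa using key
    have h := hprod i (Finset.mem_filter.mpr ⟨Finset.mem_univ _, hij, hik⟩)
    rw [hχ_eval] at h
    exact h

end Summit.ValiantsHypothesis.ValiantsHypothesis.Theorems.DetQPDetqpSuperquadratic

end
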